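import Literature.Combinatorics.Optimization.QuantumBehaviorsCpsdFormulation
import Literature.Combinatorics.Optimization.QuantumCorrelationDimensionBound
import HarnessLib

/-!
# Gram–Lorentz behaviours: unbiased binary behaviours, and behaviours all of whose quantum
# representations are exponential (Prakash–Sikora–Varvitsiotis–Wei 2017, §4.4 and §5.1–5.2)

Source: A. Prakash, J. Sikora, A. Varvitsiotis, Z. Wei, *Completely positive semidefinite rank*,
Math. Program. 171 (2018) 397–431 = arXiv:1604.07199 [PrakashEtAl2017] (held text
`paper:arxiv-1604.07199`; §4.4 on p15, §5.1 on p16–17, §5.2 on p17–19). Companion of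
`QuantumBehaviorsCpsdFormulation.lean` (Theorems 1–2: `𝒟(p)` and `𝒜(p)`) and of
`QuantumCorrelationDimensionBound.lean` (Theorem 11 `PrakashEtAl2017_thm11_holds`, Tsirelson's
theorem `PrakashEtAl2017_thm10_i_iff_iii`, and the Gribling–de Laat–Laurent sharpening
`GriblingDelaatLaurent2017_cor45`), same directory. This file moves the tree's matrix-level results
(Theorem 16: `cpsd-rank(P_{C_n}) ≥ …`, `two_pow_le_of_hasCpsdFactorization_behaviorMatrix`) to the
BEHAVIOUR language of §5: the dimension `𝒟(p)` of quantum representations of behaviours.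

Contents (all PROVED, no named facts):
* §5.1 vocabulary: `outcomeSign` (`{±1}` as `Fin 2`), `corrBehavior C` (**Definition 4**, `p_C =
  g((0,0,C))`, `p_C(ab|xy) = (1 + ab c_{xy})/4`), `corrOfBehavior p` (the correlation part
  `c_{xy} = Σ ab p(ab|xy)` of the map `f`), `IsUnbiased` (p05), `IsGramLorentzBehavior` (§4.4:
  `GL ∩ 𝒜(p) ≠ ∅`); `f ∘ g = id` and `g ∘ f = id` on unbiased behaviours;
* **Lemma 9 / Remark 5.1**, dimension-exact: a `d`-dimensional representation of `p` gives ±1-bounded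
  observables for `f(p)` (`exists_observables_of_hasQuantumRep`), and conversely at zero marginals
  (`hasQuantumRep_corrBehavior_of_observables`) and in general (`obsBehavior`,
  `hasQuantumRep_obsBehavior`, `corrOfBehavior_obsBehavior`; appended), whence **GdLL Lemma 5.2**
  (`GriblingDelaatLaurent2017_lemma52`: the minimal local dimension of the behaviour of a minimal
  tensor representation of `C` is that of `C`);
* **Lemma 10** (`isGramLorentzBehavior_corrBehavior`: `p_C` is Gram–Lorentz for `C ∈ Cor(n,m)`, by the
  Lorentz vectors `½(1, ±u_x)`, `½(1, ±v_y)`), **Remark 5.2** (`corrBehavior_mem_quantumBehaviors`);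
* **Theorem 9** (`isGramLorentzBehavior_of_isUnbiased`: unbiased binary quantum behaviours are
  Gram–Lorentz), display (16) of §4.4 (`quantumDim_le_of_isGramLorentzBehavior`:
  `𝒟 ≤ 2^{⌊(n+1)/2⌋}` on `𝒬_{GL}`, from Theorem 7 and Theorem 2) and the p05/p15 consequence
  `quantumDim_le_of_isUnbiased` (Tsirelson: finite dimension suffices for unbiased binary behaviours);
* **Theorem 12** (`PrakashEtAl2017_thm12'`: `C ∈ ext Cor(n,m)` ⇒ `p_C` Gram–Lorentz and
  `𝒟(p_C) ≥ √2^{⌊rank C/2⌋}`; sharp form `two_pow_le_quantumDim_corrBehavior`, `≥ 2^{⌊rank C/2⌋}`,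
  after Gribling–de Laat–Laurent), **Theorem 15** (`PrakashEtAl2017_thm15'`), the existence statement
  of §4.4/§5.2 (`exists_isGramLorentzBehavior_two_pow_le_quantumDim`) and "no finite dimension
  suffices for `∪_n 𝒬(n,n,2,2)`" ([VP09] as quoted on p15; `exists_quantumDim_gt`).

Design notes. Behaviours, `𝒟`, `𝒜(p)` are those of `QuantumBehaviorsCpsdFormulation.lean`
(density matrix + POVMs, Kronecker form); Theorem 11 / Cor. 4.5 are applied to the observables
`M_x = M_{1|x} − M_{−1|x}` of a `𝒟(p_C)`-dimensional representation exactly as in the printed proof of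
Theorem 12 (Remark 5.1). Theorem 15 does not use its printed hypothesis `n ≥ 1` (omitted). The small
Kronecker-product algebra (`(A ± A') ⊗ B`, scalars) is proved privately by `ext`.

NOT typed here: Theorem 16 and Result 1 (already `PrakashEtAl2017_thm16` /
`two_pow_le_of_hasCpsdFactorization_behaviorMatrix` / `PrakashEtAl2017_result1_sharp`), the explicit
example (23)–(24) of p19 (`gdllCorrelation`-type vectors live in `ExtremeBipartiteCorrelations.lean`),
the map `f` on the marginals `c_x, c_y` themselves (only the correlation part `c_{xy}` is typed).
-/

noncomputable section

open Matrix Finset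
open scoped MatrixOrder ComplexOrder Kronecker

namespace Literature.Combinatorics.Optimization


variable {mA mB n m : ℕ}

/-! ### Binary outcomes `{±1}`, full correlations, and the behaviour `p_C` of a correlation -/

/-- The outcome labels `{+1, −1}` of a binary Bell scenario, encoded by `Fin 2` (`0 ↦ +1`, `1 ↦ −1`).
[cite: PrakashEtAl2017, §5.1 (p16)] -/
def outcomeSign (a : Fin 2) : ℝ := if (a : ℕ) = 0 then 1 else -1

/-- `+1 ↦ 1`. [folklore] -/
@[simp] private theorem outcomeSign_zero : outcomeSign 0 = 1 := by simp [outcomeSign]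

/-- `−1 ↦ −1`. [folklore] -/
@[simp] private theorem outcomeSign_one : outcomeSign 1 = -1 := by simp [outcomeSign]

/-- `a² = 1` for `a ∈ {±1}`. [folklore] -/
private theorem outcomeSign_mul_self (a : Fin 2) : outcomeSign a * outcomeSign a = 1 := by
  unfold outcomeSign; split_ifs <;> norm_num

section KroneckerAlgebra

variable {d : ℕ} (A A' B B' : Matrix (Fin d) (Fin d) ℂ) (c : ℂ)

/-- `(cA) ⊗ B = c(A ⊗ B)`. [folklore] -/
private theorem smul_kronecker' : (c • A) ⊗ₖ B = c • (A ⊗ₖ B) := by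
  ext ⟨i, j⟩ ⟨i', j'⟩; simp [Matrix.kroneckerMap_apply, mul_assoc]

/-- `A ⊗ (cB) = c(A ⊗ B)`. [folklore] -/
private theorem kronecker_smul' : A ⊗ₖ (c • B) = c • (A ⊗ₖ B) := by
  ext ⟨i, j⟩ ⟨i', j'⟩; simp [Matrix.kroneckerMap_apply, mul_left_comm]

/-- `(A + A') ⊗ B = A ⊗ B + A' ⊗ B`. [folklore] -/
private theorem add_kronecker' : (A + A') ⊗ₖ B = A ⊗ₖ B + A' ⊗ₖ B := by
  ext ⟨i, j⟩ ⟨i', j'⟩; simp [Matrix.kroneckerMap_apply, add_mul]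

/-- `A ⊗ (B + B') = A ⊗ B + A ⊗ B'`. [folklore] -/
private theorem kronecker_add' : A ⊗ₖ (B + B') = A ⊗ₖ B + A ⊗ₖ B' := by
  ext ⟨i, j⟩ ⟨i', j'⟩; simp [Matrix.kroneckerMap_apply, mul_add]

/-- `(A − A') ⊗ B = A ⊗ B − A' ⊗ B`. [folklore] -/
private theorem sub_kronecker' : (A - A') ⊗ₖ B = A ⊗ₖ B - A' ⊗ₖ B := by
  ext ⟨i, j⟩ ⟨i', j'⟩; simp [Matrix.kroneckerMap_apply, sub_mul]

/-- `A ⊗ (B − B') = A ⊗ B − A ⊗ B'`. [folklore] -/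
private theorem kronecker_sub' : A ⊗ₖ (B - B') = A ⊗ₖ B - A ⊗ₖ B' := by
  ext ⟨i, j⟩ ⟨i', j'⟩; simp [Matrix.kroneckerMap_apply, mul_sub]

/-- `I ⊗ I = I`. [folklore] -/
private theorem one_kronecker_one' :
    (1 : Matrix (Fin d) (Fin d) ℂ) ⊗ₖ (1 : Matrix (Fin d) (Fin d) ℂ) = 1 := Matrix.one_kronecker_one

end KroneckerAlgebra

/-- **PSVW Definition 4** (p17, verbatim): "For any `C ∈ Cor(n,m)` we denote by `p_C = (p_C(ab|xy))` the
quantum behavior given by `g((0,0,C))`. Concretely … `p_C(ab|xy) = (1 + ab·c_{xy})/4` for all `a,b,x,y`"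
(the map `g` of §5.1, p16, at zero marginals). [cite: PrakashEtAl2017, Def. 4 (p17), §5.1 map `g` (p16)] -/
def corrBehavior (C : Matrix (Fin n) (Fin m) ℝ) : Fin n → Fin m → Fin 2 → Fin 2 → ℝ :=
  fun x y a b => (1 + outcomeSign a * outcomeSign b * C x y) / 4

/-- **The correlation part `c_{xy} = Σ_{a,b ∈ {±1}} ab·p(ab|xy)` of the map `f`** (§5.1, p16: "`c_{xy}`
corresponds to the expected value of the product of the players' outcomes").
[cite: PrakashEtAl2017, §5.1 map `f` (p16)] -/
def corrOfBehavior (p : Fin n → Fin m → Fin 2 → Fin 2 → ℝ) : Matrix (Fin n) (Fin m) ℝ :=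
  Matrix.of fun x y => ∑ a, ∑ b, outcomeSign a * outcomeSign b * p x y a b

/-- **Unbiased behaviours** (p05, verbatim): "In a Bell scenario where all the measurements have binary
outcomes, we call a behavior `(p(ab|xy))` unbiased if `p_A(a|x) = p_B(b|y) = 1/2` for all `a,b,x,y`"
(marginals `p_A(a|x) = Σ_b p(ab|xy)`, `p_B(b|y) = Σ_a p(ab|xy)`, well defined for no-signaling `p`).
[cite: PrakashEtAl2017, §1 (p05)] -/
def IsUnbiased (p : Fin n → Fin m → Fin 2 → Fin 2 → ℝ) : Prop :=
  (∀ x y a, ∑ b, p x y a b = 1 / 2) ∧ ∀ x y b, ∑ a, p x y a b = 1 / 2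

/-- **Gram–Lorentz behaviours** (§4.4, p15, verbatim): "In view of Theorem 1, to any set `𝒦 ⊆ CS_+` we
can associate a family of quantum behaviors which we denote by `𝒬_𝒦`. We refer to the quantum behaviors
`𝒬_{GL}` corresponding to `𝒦 = GL` as Gram-Lorentz behaviors": `GL ∩ 𝒜(p) ≠ ∅`.
[cite: PrakashEtAl2017, §4.4 (p15)] -/
def IsGramLorentzBehavior {oA oB : ℕ} (p : Fin mA → Fin mB → Fin oA → Fin oB → ℝ) : Prop :=
  ∃ R ∈ behaviorAffine p, IsGramLorentz R

/-- `p_C` recovers `C`: `Σ_{a,b} ab·p_C(ab|xy) = c_{xy}` (`f ∘ g = id` on the correlation part, p16).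
[cite: PrakashEtAl2017, §5.1 (p16)] -/
theorem corrOfBehavior_corrBehavior (C : Matrix (Fin n) (Fin m) ℝ) :
    corrOfBehavior (corrBehavior C) = C := by
  ext x y
  simp only [corrOfBehavior, corrBehavior, Matrix.of_apply, Fin.sum_univ_two, outcomeSign_zero,
    outcomeSign_one]
  ring

/-- `p_C` is unbiased. [cite: PrakashEtAl2017, Rem. 5.3 (p18)] -/
theorem isUnbiased_corrBehavior (C : Matrix (Fin n) (Fin m) ℝ) : IsUnbiased (corrBehavior C) := by
  refine ⟨fun x y a => ?_, fun x y b => ?_⟩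
  · simp only [corrBehavior, Fin.sum_univ_two, outcomeSign_zero, outcomeSign_one]
    ring
  · fin_cases b <;> simp only [corrBehavior, Fin.sum_univ_two, outcomeSign_zero, outcomeSign_one] <;>
      ring

/-- An unbiased behaviour with binary outcomes is `p_C` for its own correlation part
(`g ∘ f = id` on unbiased behaviours, §5.1 p16). [cite: PrakashEtAl2017, §5.1 (p16), Rem. 5.3 (p18)] -/
theorem corrBehavior_corrOfBehavior_of_isUnbiased {p : Fin n → Fin m → Fin 2 → Fin 2 → ℝ}
    (hp : IsUnbiased p) : corrBehavior (corrOfBehavior p) = p := by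
  obtain ⟨hA, hB⟩ := hp
  funext x y a b
  have h1 := hA x y 0
  have h2 := hA x y 1
  have h3 := hB x y 0
  simp only [Fin.sum_univ_two] at h1 h2 h3
  fin_cases a <;> fin_cases b <;>
    simp only [corrBehavior, corrOfBehavior, Matrix.of_apply, Fin.sum_univ_two, outcomeSign_zero,
      outcomeSign_one, Fin.zero_eta, Fin.mk_one, Fin.isValue] <;> linarith

/-! ### Lemma 9 / Remark 5.1: representations of `p` versus observables for `f(p)` -/

/-- **PSVW Lemma 9, "only if", dimension-exact (Remark 5.1)**: from a `d`-dimensional representation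
`{M_{a|x}}, {N_{b|y}}, ρ` of a binary-outcome behaviour `p`, the observables `M_x = M_{1|x} − M_{−1|x}`,
`N_y = N_{1|y} − N_{−1|y}` are Hermitian with spectra in `[−1,1]` and
`Tr((M_x ⊗ N_y)ρ) = Σ_{ab} ab·p(ab|xy) = c_{xy}`. [cite: PrakashEtAl2017, Lemma 9 (p16), Rem. 5.1 (p17)] -/
theorem exists_observables_of_hasQuantumRep {p : Fin n → Fin m → Fin 2 → Fin 2 → ℝ} {d : ℕ}
    (h : HasQuantumRep p d) :
    ∃ (M : Fin n → Matrix (Fin d) (Fin d) ℂ) (N : Fin m → Matrix (Fin d) (Fin d) ℂ)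
      (ρ : Matrix (Fin d × Fin d) (Fin d × Fin d) ℂ),
      (∀ x, (M x).IsHermitian ∧ (1 - M x).PosSemidef ∧ (1 + M x).PosSemidef) ∧
      (∀ y, (N y).IsHermitian ∧ (1 - N y).PosSemidef ∧ (1 + N y).PosSemidef) ∧
      ρ.PosSemidef ∧ ρ.trace = 1 ∧
      ∀ x y, ((corrOfBehavior p x y : ℝ) : ℂ) = ((M x ⊗ₖ N y) * ρ).trace := by
  obtain ⟨ρ, Mq, Nq, hρ, hρ1, hMq, hMq1, hNq, hNq1, hpq⟩ := h
  have hM2 : ∀ x, Mq x 0 + Mq x 1 = 1 := fun x => by rw [← hMq1 x, Fin.sum_univ_two]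
  have hN2 : ∀ y, Nq y 0 + Nq y 1 = 1 := fun y => by rw [← hNq1 y, Fin.sum_univ_two]
  refine ⟨fun x => Mq x 0 - Mq x 1, fun y => Nq y 0 - Nq y 1, ρ, fun x => ⟨?_, ?_, ?_⟩,
    fun y => ⟨?_, ?_, ?_⟩, hρ, hρ1, fun x y => ?_⟩
  · exact (hMq x 0).1.sub (hMq x 1).1
  · have : 1 - (Mq x 0 - Mq x 1) = (2 : ℂ) • Mq x 1 := by rw [← hM2 x, two_smul]; abel
    rw [this]; exact (hMq x 1).smul (by norm_num)
  · have : 1 + (Mq x 0 - Mq x 1) = (2 : ℂ) • Mq x 0 := by rw [← hM2 x, two_smul]; abel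
    rw [this]; exact (hMq x 0).smul (by norm_num)
  · exact (hNq y 0).1.sub (hNq y 1).1
  · have : 1 - (Nq y 0 - Nq y 1) = (2 : ℂ) • Nq y 1 := by rw [← hN2 y, two_smul]; abel
    rw [this]; exact (hNq y 1).smul (by norm_num)
  · have : 1 + (Nq y 0 - Nq y 1) = (2 : ℂ) • Nq y 0 := by rw [← hN2 y, two_smul]; abel
    rw [this]; exact (hNq y 0).smul (by norm_num)
  · simp only [corrOfBehavior, Matrix.of_apply, Fin.sum_univ_two, outcomeSign_zero, outcomeSign_one]
    push_cast
    rw [sub_kronecker', kronecker_sub', kronecker_sub']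
    simp only [Matrix.sub_mul, trace_sub, ← hpq]
    ring

/-- **PSVW Lemma 9, "if", dimension-exact, at zero marginals**: ±1-valued observables `M_x, N_y` and a
state `ρ` on `ℂ^d ⊗ ℂ^d` with `Tr((M_x ⊗ I)ρ) = Tr((I ⊗ N_y)ρ) = 0` and `c_{xy} = Tr((M_x ⊗ N_y)ρ)` give the
`d`-dimensional representation `M_{a|x} = (I + aM_x)/2`, `N_{b|y} = (I + bN_y)/2` of `p_C = g((0,0,C))`.
[cite: PrakashEtAl2017, Lemma 9 (p16), Rem. 5.1 (p17)] -/
theorem hasQuantumRep_corrBehavior_of_observables {C : Matrix (Fin n) (Fin m) ℝ} {d : ℕ}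
    (M : Fin n → Matrix (Fin d) (Fin d) ℂ) (N : Fin m → Matrix (Fin d) (Fin d) ℂ)
    (ρ : Matrix (Fin d × Fin d) (Fin d × Fin d) ℂ)
    (hM : ∀ x, (M x).IsHermitian ∧ (1 - M x).PosSemidef ∧ (1 + M x).PosSemidef)
    (hN : ∀ y, (N y).IsHermitian ∧ (1 - N y).PosSemidef ∧ (1 + N y).PosSemidef)
    (hρ : ρ.PosSemidef) (hρ1 : ρ.trace = 1)
    (hMA : ∀ x, ((M x ⊗ₖ (1 : Matrix (Fin d) (Fin d) ℂ)) * ρ).trace = 0)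
    (hNB : ∀ y, (((1 : Matrix (Fin d) (Fin d) ℂ) ⊗ₖ N y) * ρ).trace = 0)
    (hc : ∀ x y, ((C x y : ℝ) : ℂ) = ((M x ⊗ₖ N y) * ρ).trace) :
    HasQuantumRep (corrBehavior C) d := by
  set c : ℂ := ((1 / 2 : ℝ) : ℂ) with hcdef
  have hc0 : (0 : ℂ) ≤ c := Complex.zero_le_real.mpr (by norm_num)
  have hcc : c * c = ((1 / 4 : ℝ) : ℂ) := by rw [hcdef]; push_cast; ring
  have hc2 : c + c = 1 := by rw [hcdef]; push_cast; ring
  refine ⟨ρ, fun x a => c • 1 + (c * ((outcomeSign a : ℝ) : ℂ)) • M x,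
    fun y b => c • 1 + (c * ((outcomeSign b : ℝ) : ℂ)) • N y, hρ, hρ1, fun x a => ?_,
    fun x => ?_, fun y b => ?_, fun y => ?_, fun x y a b => ?_⟩
  · dsimp only
    have e : c • (1 : Matrix (Fin d) (Fin d) ℂ) + (c * ((outcomeSign a : ℝ) : ℂ)) • M x =
        c • (1 + ((outcomeSign a : ℝ) : ℂ) • M x) := by rw [smul_add, smul_smul]
    rw [e]
    refine PosSemidef.smul ?_ hc0
    fin_cases a
    · simpa using (hM x).2.2
    · simpa [sub_eq_add_neg] using (hM x).2.1
  · dsimp only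
    simp only [Fin.sum_univ_two, outcomeSign_zero, outcomeSign_one]
    push_cast
    rw [mul_one, mul_neg_one, neg_smul, add_add_add_comm, add_neg_cancel, add_zero, ← add_smul, hc2,
      one_smul]
  · dsimp only
    have e : c • (1 : Matrix (Fin d) (Fin d) ℂ) + (c * ((outcomeSign b : ℝ) : ℂ)) • N y =
        c • (1 + ((outcomeSign b : ℝ) : ℂ) • N y) := by rw [smul_add, smul_smul]
    rw [e]
    refine PosSemidef.smul ?_ hc0
    fin_cases b
    · simpa using (hN y).2.2
    · simpa [sub_eq_add_neg] using (hN y).2.1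
  · dsimp only
    simp only [Fin.sum_univ_two, outcomeSign_zero, outcomeSign_one]
    push_cast
    rw [mul_one, mul_neg_one, neg_smul, add_add_add_comm, add_neg_cancel, add_zero, ← add_smul, hc2,
      one_smul]
  · dsimp only
    have h1 : (((1 : Matrix (Fin d) (Fin d) ℂ) ⊗ₖ (1 : Matrix (Fin d) (Fin d) ℂ)) * ρ).trace = 1 := by
      rw [one_kronecker_one', Matrix.one_mul, hρ1]
    simp only [corrBehavior, add_kronecker', kronecker_add', smul_kronecker', kronecker_smul',
      Matrix.add_mul, Matrix.smul_mul, trace_add, trace_smul, smul_eq_mul, h1, hMA, hNB, ← hc]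
    push_cast
    rw [hcdef]
    push_cast
    ring

/-! ### Lemma 10 and Remark 5.2: `p_C` is a Gram–Lorentz (hence quantum) behaviour -/

/-- **PSVW Lemma 10** (p17, verbatim up to notation): "For any `C ∈ Cor(n,m)` the behavior `p_C` is
Gram-Lorentz. In particular, consider unit vectors `{u_x}_x` and `{v_y}_y` in `ℝ^{n+m}` such that
`c_{xy} = ⟨u_x, v_y⟩` … Then `p_C(ab|xy) = ⟨ℓ^x_a, ℓ̃^y_b⟩` where `ℓ^x_a = ½(1, a u_x)` and
`ℓ̃^y_b = ½(1, b v_y)`": the Gram matrix of these Lorentz-cone vectors lies in `GL ∩ 𝒜(p_C)`.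
[cite: PrakashEtAl2017, Lemma 10 (p17)] -/
theorem isGramLorentzBehavior_corrBehavior {C : Matrix (Fin n) (Fin m) ℝ}
    (hC : C ∈ quantumCorrelations n m) : IsGramLorentzBehavior (corrBehavior C) := by
  obtain ⟨u, v, hu, hv, hCuv⟩ := hC
  have hnu : ∀ x, ∑ l, u x l * u x l = 1 := fun x => by
    have h : inner ℝ (u x) (u x) = (1 : ℝ) := by rw [real_inner_self_eq_norm_sq, hu x, one_pow]
    rw [PiLp.inner_apply] at h
    simpa [pow_two] using h
  have hnv : ∀ y, ∑ l, v y l * v y l = 1 := fun y => by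
    have h : inner ℝ (v y) (v y) = (1 : ℝ) := by rw [real_inner_self_eq_norm_sq, hv y, one_pow]
    rw [PiLp.inner_apply] at h
    simpa [pow_two] using h
  have hCuv' : ∀ x y, C x y = ∑ l, u x l * v y l := fun x y => by
    rw [hCuv]; simp [PiLp.inner_apply, mul_comm]
  set cv : BellIndex n m 2 2 → ℝ := fun _ => 1 / 2 with hcv
  set xv : BellIndex n m 2 2 → Fin (n + m) → ℝ :=
    Sum.elim (fun xa l => outcomeSign xa.2 * u xa.1 l / 2)
      (fun yb l => outcomeSign yb.2 * v yb.1 l / 2) with hxv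
  -- the mixed products `Σ_l (s u_l/2)(s' w_l/2) = (s s'/4) Σ_l u_l w_l`
  have hmix : ∀ (s s' : ℝ) (f g : Fin (n + m) → ℝ),
      ∑ l, s * f l / 2 * (s' * g l / 2) = s * s' / 4 * ∑ l, f l * g l := by
    intro s s' f g
    rw [Finset.mul_sum]
    exact Finset.sum_congr rfl fun l _ => by ring
  refine ⟨fun i j => cv i * cv j + ∑ l, xv i l * xv j l, ⟨?_, fun x x' => ?_, fun x y => ?_,
    fun y y' => ?_, fun x y a b => ?_⟩, n + m, cv, xv, fun i => ?_, fun i j => rfl⟩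
  · ext i j
    simp only [transpose_apply, mul_comm (cv i), mul_comm (xv i _)]
  · simp only [hcv, hxv, Sum.elim_inl, hmix, Fin.sum_univ_two, outcomeSign_zero, outcomeSign_one]
    ring
  · simp only [hcv, hxv, Sum.elim_inl, Sum.elim_inr, hmix, Fin.sum_univ_two, outcomeSign_zero,
      outcomeSign_one]
    ring
  · simp only [hcv, hxv, Sum.elim_inr, hmix, Fin.sum_univ_two, outcomeSign_zero, outcomeSign_one]
    ring
  · simp only [hcv, hxv, Sum.elim_inl, Sum.elim_inr, hmix, corrBehavior, ← hCuv']
    ring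
  · -- `‖½ s u‖ = ½`
    have hsq : ∑ l, xv i l ^ 2 = (1 / 2) ^ 2 := by
      rcases i with ⟨x, a⟩ | ⟨y, b⟩
      · simp only [hxv, Sum.elim_inl]
        calc ∑ l, (outcomeSign a * u x l / 2) ^ 2
            = outcomeSign a * outcomeSign a / 4 * ∑ l, u x l * u x l := by
              rw [Finset.mul_sum]; exact Finset.sum_congr rfl fun l _ => by ring
          _ = (1 / 2) ^ 2 := by rw [outcomeSign_mul_self, hnu]; norm_num
      · simp only [hxv, Sum.elim_inr]
        calc ∑ l, (outcomeSign b * v y l / 2) ^ 2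
            = outcomeSign b * outcomeSign b / 4 * ∑ l, v y l * v y l := by
              rw [Finset.mul_sum]; exact Finset.sum_congr rfl fun l _ => by ring
          _ = (1 / 2) ^ 2 := by rw [outcomeSign_mul_self, hnv]; norm_num
    rw [hsq, Real.sqrt_sq (by norm_num : (0 : ℝ) ≤ 1 / 2)]

/-- A Gram–Lorentz behaviour is a quantum behaviour (`GL ⊆ CS_+`, Theorem 7, and Theorem 1).
[cite: PrakashEtAl2017, §4.4 (p15), Thm. 7 (p14), Thm. 1 (p05)] -/
theorem IsGramLorentzBehavior.mem_quantumBehaviors {oA oB : ℕ}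
    {p : Fin mA → Fin mB → Fin oA → Fin oB → ℝ} (h : IsGramLorentzBehavior p) :
    p ∈ quantumBehaviors mA mB oA oB := by
  obtain ⟨R, hR, hGL⟩ := h
  exact (mem_quantumBehaviors_iff p).mpr ⟨R, hR, hGL.isCpsd⟩

/-- **PSVW Remark 5.2** (p17): "the behavior `p_C` is well-defined [as a quantum behaviour] … as
`(0,0,C)` is a full quantum correlation vector for any `C ∈ Cor(n,m)`" — here via Lemma 10 and
Theorem 1. [cite: PrakashEtAl2017, Rem. 5.2 (p17), Lemma 10 (p17)] -/
theorem corrBehavior_mem_quantumBehaviors {C : Matrix (Fin n) (Fin m) ℝ}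
    (hC : C ∈ quantumCorrelations n m) : corrBehavior C ∈ quantumBehaviors n m 2 2 :=
  (isGramLorentzBehavior_corrBehavior hC).mem_quantumBehaviors

/-! ### Theorem 9 and the finite-dimensionality of unbiased binary behaviours (§4.4, eq. before Thm 9) -/

/-- **PSVW Theorem 9** (p15, verbatim): "In any `(m_A,m_B,2,2)`-scenario, all unbiased quantum
behaviors are Gram-Lorentz behaviors" (Remark 5.3: an unbiased `p ∈ 𝒬` equals `p_C` for its
correlation part `C = f(p) ∈ Cor(m_A,m_B)`, then Lemma 10).
[cite: PrakashEtAl2017, Thm. 9 (p15), Rem. 5.3 (p18)] -/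
theorem isGramLorentzBehavior_of_isUnbiased {p : Fin n → Fin m → Fin 2 → Fin 2 → ℝ}
    (hp : p ∈ quantumBehaviors n m 2 2) (hu : IsUnbiased p) : IsGramLorentzBehavior p := by
  obtain ⟨d, hd⟩ := hp
  obtain ⟨M, N, ρ, hM, hN, hρ, hρ1, hc⟩ := exists_observables_of_hasQuantumRep hd
  have hC : corrOfBehavior p ∈ quantumCorrelations n m :=
    mem_quantumCorrelations_of_tensorRep M N ρ hM hN hρ hρ1 hc
  rw [← corrBehavior_corrOfBehavior_of_isUnbiased hu]
  exact isGramLorentzBehavior_corrBehavior hC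

/-- **"`max{𝒟(p) : p ∈ 𝒬_{GL}} < +∞`"** (§4.4, p15, display (16), "by Theorem 7"): a Gram–Lorentz
behaviour of an `(m_A,m_B,o_A,o_B)`-scenario has `𝒟(p) ≤ 2^{⌊(n+1)/2⌋}`, `n = m_A o_A + m_B o_B`
(Theorem 7: `cpsd-rank(R) ≤ 2^{⌊(rank R + 1)/2⌋}`, `rank R ≤ n`, and Theorem 2).
[cite: PrakashEtAl2017, §4.4 (p15), Thm. 7 (p14), Thm. 2 (p05)] -/
theorem quantumDim_le_of_isGramLorentzBehavior {oA oB : ℕ}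
    {p : Fin mA → Fin mB → Fin oA → Fin oB → ℝ} (h : IsGramLorentzBehavior p) :
    quantumDim p ≤ 2 ^ ((mA * oA + mB * oB + 1) / 2) := by
  obtain ⟨R, hR, hGL⟩ := h
  have hf := PrakashEtAl2017_thm7_holds (BellIndex mA mB oA oB) R hGL
  have h1 := quantumDim_le_of_hasCpsdFactorization hR hf (Nat.two_pow_pos _)
  refine le_trans h1 (Nat.pow_le_pow_right two_pos (Nat.div_le_div_right ?_))
  have hr := Matrix.rank_le_card_width R
  simp only [Fintype.card_sum, Fintype.card_prod, Fintype.card_fin] at hr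
  omega

/-- **Tsirelson's finite-dimensionality for unbiased binary behaviours** (p05, verbatim: "It follows
from the work of Tsirelson [TS87] that in a `(m_A,m_B,2,2)`-scenario finite dimensions are sufficient
to generate all unbiased behaviors"; recovered on p15 by combining (16) with Theorem 9):
`𝒟(p) ≤ 2^{⌊(2m_A+2m_B+1)/2⌋}` for every unbiased `p ∈ 𝒬(m_A,m_B,2,2)`.
[cite: PrakashEtAl2017, §1 (p05), §4.4 (p15)] -/
theorem quantumDim_le_of_isUnbiased {p : Fin n → Fin m → Fin 2 → Fin 2 → ℝ}
    (hp : p ∈ quantumBehaviors n m 2 2) (hu : IsUnbiased p) :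
    quantumDim p ≤ 2 ^ ((n * 2 + m * 2 + 1) / 2) :=
  quantumDim_le_of_isGramLorentzBehavior (isGramLorentzBehavior_of_isUnbiased hp hu)

/-! ### Theorems 12 and 15: Gram–Lorentz behaviours all of whose representations are exponential -/

/-- **PSVW Theorem 12** (p18, verbatim): "For any `C ∈ ext(Cor(n,m))` we have that `p_C` is
Gram-Lorentz and `𝒟(p_C) ≥ √2^{⌊rank(C)/2⌋}`" (Lemma 10; Remark 5.1 turns a `𝒟(p_C)`-dimensional
representation of `p_C` into observables for `(0,0,C)`; Theorem 11).
[cite: PrakashEtAl2017, Thm. 12 (p18), Rem. 5.1 (p17), Thm. 11 (p17)] -/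
theorem PrakashEtAl2017_thm12' {C : Matrix (Fin n) (Fin m) ℝ}
    (hC : C ∈ Set.extremePoints ℝ (quantumCorrelations n m)) :
    IsGramLorentzBehavior (corrBehavior C) ∧
      Real.sqrt 2 ^ (C.rank / 2) ≤ (quantumDim (corrBehavior C) : ℝ) := by
  have hCQ : C ∈ quantumCorrelations n m := hC.1
  refine ⟨isGramLorentzBehavior_corrBehavior hCQ, ?_⟩
  obtain ⟨M, N, ρ, hM, hN, hρ, hρ1, hc⟩ :=
    exists_observables_of_hasQuantumRep (hasQuantumRep_quantumDim (corrBehavior_mem_quantumBehaviors hCQ))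
  rw [corrOfBehavior_corrBehavior] at hc
  exact PrakashEtAl2017_thm11_holds n m _ C hC M N ρ hM hN hρ hρ1 hc

/-- **Theorem 12 with the sharp exponent** `𝒟(p_C) ≥ 2^{⌊rank(C)/2⌋}` (Gribling–de Laat–Laurent 2017,
Cor. 4.5, through `GriblingDelaatLaurent2017_cor45`). [cite: GriblingDelaatLaurent2017, Cor. 4.5 (p14);
PrakashEtAl2017, Thm. 12 (p18)] -/
theorem two_pow_le_quantumDim_corrBehavior {C : Matrix (Fin n) (Fin m) ℝ}
    (hC : C ∈ Set.extremePoints ℝ (quantumCorrelations n m)) :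
    2 ^ (C.rank / 2) ≤ quantumDim (corrBehavior C) := by
  obtain ⟨M, N, ρ, hM, hN, hρ, hρ1, hc⟩ :=
    exists_observables_of_hasQuantumRep (hasQuantumRep_quantumDim (corrBehavior_mem_quantumBehaviors hC.1))
  rw [corrOfBehavior_corrBehavior] at hc
  exact GriblingDelaatLaurent2017_cor45 hC M N ρ hM hN hρ hρ1 hc

/-- **PSVW Theorem 15** (p19, verbatim): "Fix `n ≥ 1` and let `C_n ∈ ext(𝓔_n)` with
`rank(C_n) = r_max(n)`. Then `𝒟(p_{C_n}) ≥ √2^{⌊r_max(n)/2⌋}`" (Proposition 2: `ext(𝓔_n) ⊆ ext(Cor(n,n))`,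
then Theorem 12; the printed `n ≥ 1` is not used). [cite: PrakashEtAl2017, Thm. 15 (p19), Prop. 2 (p18)] -/
theorem PrakashEtAl2017_thm15' {n : ℕ} {C : Matrix (Fin n) (Fin n) ℝ}
    (hC : C ∈ Set.extremePoints ℝ (elliptope n)) (hr : C.rank = elliptopeMaxRank n) :
    Real.sqrt 2 ^ (elliptopeMaxRank n / 2) ≤ (quantumDim (corrBehavior C) : ℝ) := by
  rw [← hr]
  exact (PrakashEtAl2017_thm12' (PrakashEtAl2017_prop2 hC)).2

/-- **Gram–Lorentz behaviours needing exponential dimension** (§4.4 p15 and §5.2 p17, verbatim: "for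
any `n ≥ 1` there exists a Gram-Lorentz behavior `p_n` corresponding to the `(n,n,2,2)`-scenario
satisfying `𝒟(p_n) ≥ 2^{Ω(√n)}`"; Theorems 14 and 15), with the sharp exponent `2^{⌊r_max(n)/2⌋}`.
[cite: PrakashEtAl2017, §4.4 (p15), Thm. 15 (p19), Thm. 14 (p18); GriblingDelaatLaurent2017, Cor. 4.5 (p14)] -/
theorem exists_isGramLorentzBehavior_two_pow_le_quantumDim {n : ℕ} (hn : 1 ≤ n) :
    ∃ p ∈ quantumBehaviors n n 2 2, IsGramLorentzBehavior p ∧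
      2 ^ (elliptopeMaxRank n / 2) ≤ quantumDim p := by
  have hr : 1 ≤ elliptopeMaxRank n := by
    unfold elliptopeMaxRank
    have h9 : 3 ≤ Nat.sqrt (1 + 8 * n) := by
      rw [Nat.le_sqrt]
      omega
    omega
  obtain ⟨C, hC, hrank⟩ := (PrakashEtAl2017_thm14_holds n).2 (elliptopeMaxRank n) hr le_rfl
  have hC' := PrakashEtAl2017_prop2 hC
  refine ⟨corrBehavior C, corrBehavior_mem_quantumBehaviors hC'.1,
    isGramLorentzBehavior_corrBehavior hC'.1, ?_⟩
  rw [← hrank]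
  exact two_pow_le_quantumDim_corrBehavior hC'

/-- **No finite dimension suffices for all binary scenarios** (p15, verbatim: "As an immediate
consequence of this fact we get that no finite dimension suffices to generate all behaviors in
`∪_{n ≥ 1} 𝒬(n,n,2,2)`. This was the main result in [VP09]"): for every `d` some quantum behaviour of
some `(n,n,2,2)`-scenario has `𝒟(p) > d` (take `n = k(k+1)/2` with `k = 2(d+1)`, so `r_max(n) = k`).
[cite: PrakashEtAl2017, §4.4 (p15)] -/
theorem exists_quantumDim_gt (d : ℕ) :
    ∃ (n : ℕ) (p : Fin n → Fin n → Fin 2 → Fin 2 → ℝ), p ∈ quantumBehaviors n n 2 2 ∧ d < quantumDim p := by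
  set k : ℕ := 2 * (d + 1) with hk
  set n : ℕ := k * (k + 1) / 2 with hn
  have hkn : k * (k + 1) = 2 * n := by
    rw [hn]
    have : 2 ∣ k * (k + 1) := by rw [hk]; exact Dvd.dvd.mul_right (dvd_mul_right 2 _) _
    omega
  have hrmax : elliptopeMaxRank n = k := by
    unfold elliptopeMaxRank
    have : 1 + 8 * n = (2 * k + 1) * (2 * k + 1) := by nlinarith [hkn]
    rw [this, Nat.sqrt_eq]
    omega
  have hn1 : 1 ≤ n := by
    rw [hn, hk]
    exact Nat.le_div_iff_mul_le two_pos |>.mpr (by nlinarith)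
  obtain ⟨p, hp, -, hdim⟩ := exists_isGramLorentzBehavior_two_pow_le_quantumDim hn1
  refine ⟨n, p, hp, lt_of_lt_of_le ?_ hdim⟩
  rw [hrmax, hk, show 2 * (d + 1) / 2 = d + 1 from Nat.mul_div_cancel_left _ two_pos]
  calc d < 2 ^ d := Nat.lt_two_pow_self
    _ ≤ 2 ^ (d + 1) := Nat.pow_le_pow_right two_pos (Nat.le_succ d)

/-! ### Lemma 9 with general marginals and GdLL Lemma 5.2 (appended) -/

section GeneralMarginals

variable {d : ℕ}

/-- For Hermitian `A, B` the trace `Tr(AB)` is real. [folklore] -/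
private theorem re_trace_mul_of_isHermitian' {ι : Type*} [Fintype ι] {A B : Matrix ι ι ℂ}
    (hA : A.IsHermitian) (hB : B.IsHermitian) : (((A * B).trace.re : ℝ) : ℂ) = (A * B).trace := by
  apply Complex.conj_eq_iff_re.mp
  change star (A * B).trace = (A * B).trace
  rw [← Matrix.trace_conjTranspose, Matrix.conjTranspose_mul, hA.eq, hB.eq, Matrix.trace_mul_comm]

/-- The POVM element `(I + aM)/2` of an observable `M` (PSVW Lemma 9, proof; GdLL Lemma 5.2, proof,
display (20) in the arXiv numbering).
[cite: PrakashEtAl2017, Lemma 9, proof (p16); GriblingDelaatLaurent2017, Lemma 5.2 proof, (20) (p16)] -/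
def povmElt (M : Matrix (Fin d) (Fin d) ℂ) (a : Fin 2) : Matrix (Fin d) (Fin d) ℂ :=
  ((1 / 2 : ℝ) : ℂ) • 1 + (((1 / 2 : ℝ) : ℂ) * ((outcomeSign a : ℝ) : ℂ)) • M

/-- **The behaviour of a family of ±1-bounded observables and a state** (PSVW Lemma 9, proof of "if",
p16, verbatim): "set `M_{a|x} = (I + aM_x)/2` and … `N_{b|y} = (I + bN_y)/2` … defining the quantum
behavior `p` where `p(ab|xy) = Tr((M_{a|x} ⊗ N_{b|y})ρ)`".
[cite: PrakashEtAl2017, Lemma 9, proof (p16); GriblingDelaatLaurent2017, Lemma 5.2, proof (p16)] -/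
def obsBehavior (M : Fin n → Matrix (Fin d) (Fin d) ℂ) (N : Fin m → Matrix (Fin d) (Fin d) ℂ)
    (ρ : Matrix (Fin d × Fin d) (Fin d × Fin d) ℂ) : Fin n → Fin m → Fin 2 → Fin 2 → ℝ :=
  fun x y a b => (((povmElt (M x) a ⊗ₖ povmElt (N y) b) * ρ).trace).re

/-- `(I + aM)/2` is psd for a ±1-bounded observable `M`. [cite: PrakashEtAl2017, Lemma 9, proof (p16)] -/
theorem posSemidef_povmElt {M : Matrix (Fin d) (Fin d) ℂ}
    (hM : M.IsHermitian ∧ (1 - M).PosSemidef ∧ (1 + M).PosSemidef) (a : Fin 2) :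
    (povmElt M a).PosSemidef := by
  have e : povmElt M a = ((1 / 2 : ℝ) : ℂ) • (1 + ((outcomeSign a : ℝ) : ℂ) • M) := by
    rw [povmElt, smul_add, smul_smul]
  rw [e]
  refine PosSemidef.smul ?_ (Complex.zero_le_real.mpr (by norm_num))
  fin_cases a
  · simpa using hM.2.2
  · simpa [sub_eq_add_neg] using hM.2.1

/-- `(I + M)/2 + (I − M)/2 = I`. [cite: PrakashEtAl2017, Lemma 9, proof (p16)] -/
theorem sum_povmElt (M : Matrix (Fin d) (Fin d) ℂ) : ∑ a : Fin 2, povmElt M a = 1 := by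
  have hc2 : ((1 / 2 : ℝ) : ℂ) + ((1 / 2 : ℝ) : ℂ) = 1 := by push_cast; ring
  simp only [povmElt, Fin.sum_univ_two, outcomeSign_zero, outcomeSign_one]
  push_cast
  rw [mul_one, mul_neg_one, neg_smul, add_add_add_comm, add_neg_cancel, add_zero, ← add_smul]
  push_cast at hc2
  rw [hc2, one_smul]

/-- The defining traces of `obsBehavior` are real. [cite: PrakashEtAl2017, Lemma 9 (p16)] -/
theorem obsBehavior_coe {M : Fin n → Matrix (Fin d) (Fin d) ℂ} {N : Fin m → Matrix (Fin d) (Fin d) ℂ}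
    {ρ : Matrix (Fin d × Fin d) (Fin d × Fin d) ℂ}
    (hM : ∀ x, (M x).IsHermitian ∧ (1 - M x).PosSemidef ∧ (1 + M x).PosSemidef)
    (hN : ∀ y, (N y).IsHermitian ∧ (1 - N y).PosSemidef ∧ (1 + N y).PosSemidef)
    (hρ : ρ.PosSemidef) (x : Fin n) (y : Fin m) (a b : Fin 2) :
    ((obsBehavior M N ρ x y a b : ℝ) : ℂ) = ((povmElt (M x) a ⊗ₖ povmElt (N y) b) * ρ).trace := by
  unfold obsBehavior
  refine re_trace_mul_of_isHermitian' ?_ hρ.1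
  have hA := (posSemidef_povmElt (hM x) a).1
  have hB := (posSemidef_povmElt (hN y) b).1
  rw [Matrix.IsHermitian, Matrix.conjTranspose_kronecker, hA.eq, hB.eq]

/-- **PSVW Lemma 9, "if", dimension-exact, general marginals**: ±1-bounded observables and a state on
`ℂ^d ⊗ ℂ^d` give a `d`-dimensional representation of `obsBehavior M N ρ`.
[cite: PrakashEtAl2017, Lemma 9 (p16), Rem. 5.1 (p17)] -/
theorem hasQuantumRep_obsBehavior (M : Fin n → Matrix (Fin d) (Fin d) ℂ)
    (N : Fin m → Matrix (Fin d) (Fin d) ℂ) (ρ : Matrix (Fin d × Fin d) (Fin d × Fin d) ℂ)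
    (hM : ∀ x, (M x).IsHermitian ∧ (1 - M x).PosSemidef ∧ (1 + M x).PosSemidef)
    (hN : ∀ y, (N y).IsHermitian ∧ (1 - N y).PosSemidef ∧ (1 + N y).PosSemidef)
    (hρ : ρ.PosSemidef) (hρ1 : ρ.trace = 1) : HasQuantumRep (obsBehavior M N ρ) d :=
  ⟨ρ, fun x a => povmElt (M x) a, fun y b => povmElt (N y) b, hρ, hρ1,
    fun x a => posSemidef_povmElt (hM x) a, fun x => sum_povmElt (M x),
    fun y b => posSemidef_povmElt (hN y) b, fun y => sum_povmElt (N y),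
    fun x y a b => obsBehavior_coe hM hN hρ x y a b⟩

/-- The correlation part of `obsBehavior M N ρ` is `c_{xy} = Tr((M_x ⊗ N_y)ρ)` (PSVW Lemma 9; GdLL
Lemma 5.2, display (19) in the arXiv numbering: `C(s,t) = p(00|st) + p(11|st) − p(01|st) − p(10|st)`).
[cite: PrakashEtAl2017, Lemma 9 (p16); GriblingDelaatLaurent2017, Lemma 5.2, (19) (p16)] -/
theorem corrOfBehavior_obsBehavior (M : Fin n → Matrix (Fin d) (Fin d) ℂ)
    (N : Fin m → Matrix (Fin d) (Fin d) ℂ) (ρ : Matrix (Fin d × Fin d) (Fin d × Fin d) ℂ)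
    (hM : ∀ x, (M x).IsHermitian ∧ (1 - M x).PosSemidef ∧ (1 + M x).PosSemidef)
    (hN : ∀ y, (N y).IsHermitian ∧ (1 - N y).PosSemidef ∧ (1 + N y).PosSemidef)
    (hρ : ρ.PosSemidef) (hρ1 : ρ.trace = 1) (x : Fin n) (y : Fin m) :
    ((corrOfBehavior (obsBehavior M N ρ) x y : ℝ) : ℂ) = ((M x ⊗ₖ N y) * ρ).trace := by
  have h1 : (((1 : Matrix (Fin d) (Fin d) ℂ) ⊗ₖ (1 : Matrix (Fin d) (Fin d) ℂ)) * ρ).trace = 1 := by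
    rw [one_kronecker_one', Matrix.one_mul, hρ1]
  simp only [corrOfBehavior, Matrix.of_apply, Fin.sum_univ_two]
  push_cast
  simp only [obsBehavior_coe hM hN hρ, povmElt, outcomeSign_zero, outcomeSign_one, add_kronecker',
    kronecker_add', smul_kronecker', kronecker_smul', Matrix.add_mul, Matrix.smul_mul, trace_add,
    trace_smul, smul_eq_mul, h1]
  push_cast
  ring

/-- **Gribling–de Laat–Laurent 2017, Lemma 5.2** (p16, verbatim up to the representation format):
"Let `C ∈ Cor(m,n)` and assume `C` admits a tensor operator representation in local dimension `d`, but
does not admit a tensor operator representation in smaller dimension. Then there exists a quantum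
correlation `p` defined on `{0,1} × {0,1} × [m] × [n]`, satisfying the relations
`C(s,t) = p(0,0|s,t) + p(1,1|s,t) − p(0,1|s,t) − p(1,0|s,t)`, that can be realized in local dimension
`d`, but cannot be realized in smaller dimension." Tensor operator representations are taken in the
tree's form (observables with `−I ⪯ M ⪯ I`, a density matrix `ρ` on `ℂ^d ⊗ ℂ^d`,
`c = Tr((M ⊗ N)ρ)`, as in `PrakashEtAl2017_thm11`); "realized in local dimension `d`" is the pure-state
`HasPureQuantumRep` (GdLL §5, displays (14)–(15) in the arXiv numbering), equivalently `HasQuantumRep`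
(`hasPureQuantumRep_iff_hasQuantumRep`).
[cite: GriblingDelaatLaurent2017, Lemma 5.2 (p16)] -/
theorem GriblingDelaatLaurent2017_lemma52 {C : Matrix (Fin n) (Fin m) ℝ}
    (hrep : ∃ (M : Fin n → Matrix (Fin d) (Fin d) ℂ) (N : Fin m → Matrix (Fin d) (Fin d) ℂ)
      (ρ : Matrix (Fin d × Fin d) (Fin d × Fin d) ℂ),
      (∀ x, (M x).IsHermitian ∧ (1 - M x).PosSemidef ∧ (1 + M x).PosSemidef) ∧
      (∀ y, (N y).IsHermitian ∧ (1 - N y).PosSemidef ∧ (1 + N y).PosSemidef) ∧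
      ρ.PosSemidef ∧ ρ.trace = 1 ∧ ∀ x y, ((C x y : ℝ) : ℂ) = ((M x ⊗ₖ N y) * ρ).trace)
    (hmin : ∀ d' < d, ¬ ∃ (M : Fin n → Matrix (Fin d') (Fin d') ℂ)
      (N : Fin m → Matrix (Fin d') (Fin d') ℂ) (ρ : Matrix (Fin d' × Fin d') (Fin d' × Fin d') ℂ),
      (∀ x, (M x).IsHermitian ∧ (1 - M x).PosSemidef ∧ (1 + M x).PosSemidef) ∧
      (∀ y, (N y).IsHermitian ∧ (1 - N y).PosSemidef ∧ (1 + N y).PosSemidef) ∧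
      ρ.PosSemidef ∧ ρ.trace = 1 ∧ ∀ x y, ((C x y : ℝ) : ℂ) = ((M x ⊗ₖ N y) * ρ).trace) :
    ∃ p : Fin n → Fin m → Fin 2 → Fin 2 → ℝ, corrOfBehavior p = C ∧ HasPureQuantumRep p d ∧
      ∀ d' < d, ¬ HasPureQuantumRep p d' := by
  obtain ⟨M, N, ρ, hM, hN, hρ, hρ1, hc⟩ := hrep
  have hC : corrOfBehavior (obsBehavior M N ρ) = C := by
    ext x y
    exact_mod_cast (corrOfBehavior_obsBehavior M N ρ hM hN hρ hρ1 x y).trans (hc x y).symm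
  refine ⟨obsBehavior M N ρ, hC,
    hasPureQuantumRep_iff_hasQuantumRep.mpr (hasQuantumRep_obsBehavior M N ρ hM hN hρ hρ1),
    fun d' hd' hp' => hmin d' hd' ?_⟩
  obtain ⟨M', N', ρ', hM', hN', hρ', hρ1', hc'⟩ :=
    exists_observables_of_hasQuantumRep hp'.hasQuantumRep
  rw [hC] at hc'
  exact ⟨M', N', ρ', hM', hN', hρ', hρ1', hc'⟩

end GeneralMarginals

end Literature.Combinatorics.Optimization
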